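import Summits.QuantumFields.YangMills.Theses.ColdStartUniversality

/-!
# Assembly of route `ColdStartUniversality` (rung R3 of LADDER-YM, leaf `T3YM3TorusStatement.YM3TorusSU2`; item stmt-QuantumFields-24812)

The route file's kernel-checked deciding theorem `closes` packaged as the proof of the route's `Assembly` item:
`UniformColdStartMixing → ColdStartContinuumCauchy → ColdStartSolutionsExist → YM3TorusSU2`.  No summit and no Clay statement is proved here; the
rung `YM3TorusSU2` (a RECORD rung) stays open behind the route's open cruxes and its support `ColdStartSolutionsExist` (worked by the route's own seat).
Filed by the width seat `ym-line-sfw-p2-w2` gen 16 (route affinity: rung R3) as one-line bookkeeping only.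
-/

namespace Summit.QuantumFields.YangMills.Theorems

open Summit.QuantumFields.YangMills.Theses.ColdStartUniversality in
/-- The `Assembly` item of route `ColdStartUniversality` holds: it is the route's deciding theorem `closes` read as an implication. Nothing about the mass gap. -/
theorem coldStartUniversality_assembly : Summit.QuantumFields.YangMills.Theses.ColdStartUniversality.Assembly :=
  -- rev 3 of the route file (2026-08-28T10:11Z) re-keyed `closes` to the centre-NEUTRAL mixing hypothesis `NeutralColdStartMixing`,
  -- which `UniformColdStartMixing` implies a fortiori (the neutral-sector condition on `os` is simply dropped); statement unchanged.
  fun hA1 hA2 hEx =>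
    closes (by
      obtain ⟨γ₁, hγ₁, h⟩ := hA1
      exact ⟨γ₁, hγ₁, fun F γ hγ hγle os _ => h F γ hγ hγle os⟩) hA2 hEx

end Summit.QuantumFields.YangMills.Theorems
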